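import Summits.QuantumFields.YangMills.Theorems.NPointIsotropy.Negative.TieLoadBearing
import Summits.QuantumFields.YangMills.Theorems.MirrorModularBoostsPlanarSpectralCone
import Summits.QuantumFields.YangMills.Theorems.MirrorModularBoostsKernelBoundEngineGlue
import HarnessLib

/-!
# `NPointIsotropy` FOLLOWS FROM the sibling crux `CurvatureBoostCovariance` (and from its two halves)

Support file for crux `stmt-QuantumFields-11686` (`PencilRigidity.NPointIsotropy`), line `complex-rotation-bandlimit`,
lead c3.  A structural certificate, pure logic over landed theorems:

* `nPointIsotropy_of_curvatureBoostCovariance` — `MirrorModularBoosts.CurvatureBoostCovariance → PencilRigidity.NPointIsotropy`.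
  Both cruxes carry the same curvature package `W₁` and the same eight-frame reflection positivity and have the same
  conclusion (planar invariance of every `𝔖ₙ` on `⁰𝒮`); they differ in ONE hypothesis: the sibling asks for the planar
  spectral cone, this crux for the radial two-point kernel.  But the cone is a THEOREM for every family with E0', E3,
  translations and the eight frames (`PlanarSpectralCone_of`, the closed item stmt-QuantumFields-9664), and those are in
  `W₁`; so the sibling's hypotheses are implied by this crux's, and the radial kernel is not even used.  Consequently
  every proof of stmt-QuantumFields-9663 closes stmt-QuantumFields-11686 in one line, and the three registered residual
  stubs of this line (Step 0, the `n ≥ 2` analytic input, the level-growth bet — byte-identical with 9663's) need to be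
  worked once.
* `nPointIsotropy_of_kernelBound_of_softKernel` — the same through the landed glue `kernelBoundEngineGlue_proof`
  (stmt-QuantumFields-15000): `CurvatureKernelBound → SoftKernelBoostCovariance → NPointIsotropy`.
* `nPointIsotropy_of_kernelBound_of_softKernel'` — with this route's own copy `PencilRigidity.CurvatureKernelBound`
  (stmt-QuantumFields-11687, verbatim the sibling route's decl) in the first slot.
[folklore]
-/

noncomputable section

namespace Summit.QuantumFields.YangMills.Theorems.NPointIsotropy.ComplexRotationBandlimit

open Literature.MathematicalPhysics.QuantumLattice Literature.MathematicalPhysics.AQFT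
  Literature.MathematicalPhysics.QuantumFieldTheory
open Summit.QuantumFields.YangMills.Theorems.NPointIsotropy.Negative (nPointIsotropy_iff)
open Summit.QuantumFields.YangMills.Theorems.CurvatureBoostCovariance.Negative (PlanarCone crux_iff)

/-- **The sibling crux implies this crux.**  `CurvatureBoostCovariance` (stmt-QuantumFields-9663) unbundles to
`W1 → EightFrameRP → PlanarCone → PlanarInvariant` and `NPointIsotropy` to `W1 → EightFrameRP → RadialKernel → PlanarInvariant`
(both `Iff.rfl`); the cone is supplied by the landed theorem `PlanarSpectralCone_of` (stmt-QuantumFields-9664) from E0', E3 and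
translations (inside `W1`) and the eight frames; the radial kernel is discarded. [folklore] -/
theorem nPointIsotropy_of_curvatureBoostCovariance : Summit.QuantumFields.YangMills.Theses.MirrorModularBoosts.CurvatureBoostCovariance → Summit.QuantumFields.YangMills.Theses.PencilRigidity.NPointIsotropy := by
  intro hCBC
  rw [nPointIsotropy_iff]
  intro G _ _ _ _ hG r sch S₁ hW h8 _
  have hC : PlanarCone S₁ :=
    Summit.QuantumFields.YangMills.Cruxes.PlanarSpectralCone.PositivityDiscToOperatorCone.PlanarSpectralCone_of
      S₁ hW.2.1.2.2.1 hW.2.1.2.2.2.2.1 hW.2.2.1 h8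
  exact (crux_iff.mp hCBC) G hG r sch S₁ hW h8 hC

/-- **The two halves of the sibling engine imply this crux**: `CurvatureKernelBound` (stmt-QuantumFields-11687, the UV datum)
and `SoftKernelBoostCovariance` (stmt-QuantumFields-14999, the engine below dimension five) give `CurvatureBoostCovariance` by
the landed glue `kernelBoundEngineGlue_proof` (stmt-QuantumFields-15000), hence `NPointIsotropy`. [folklore] -/
theorem nPointIsotropy_of_kernelBound_of_softKernel : Summit.QuantumFields.YangMills.Theses.MirrorModularBoosts.CurvatureKernelBound → Summit.QuantumFields.YangMills.Theses.MirrorModularBoosts.SoftKernelBoostCovariance → Summit.QuantumFields.YangMills.Theses.PencilRigidity.NPointIsotropy :=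
  fun hKB hSoft => nPointIsotropy_of_curvatureBoostCovariance
    (Summit.QuantumFields.YangMills.Theorems.kernelBoundEngineGlue_proof hKB hSoft)

/-- The same with THIS route's copy of the kernel bound, `PencilRigidity.CurvatureKernelBound` (stmt-QuantumFields-11687 is
shared by the two routes; the two decls are syntactically identical). [folklore] -/
theorem nPointIsotropy_of_kernelBound_of_softKernel' : Summit.QuantumFields.YangMills.Theses.PencilRigidity.CurvatureKernelBound → Summit.QuantumFields.YangMills.Theses.MirrorModularBoosts.SoftKernelBoostCovariance → Summit.QuantumFields.YangMills.Theses.PencilRigidity.NPointIsotropy :=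
  fun hKB hSoft => nPointIsotropy_of_kernelBound_of_softKernel (fun G _ _ _ _ hG => hKB G hG) hSoft

end Summit.QuantumFields.YangMills.Theorems.NPointIsotropy.ComplexRotationBandlimit

end
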